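import Summits.QuantumFields.YangMills.Theorems.BalabanUVNodesN09TowerChartOfPerBondCharts
import Literature.MathematicalPhysics.QuantumFieldTheory.Balaban1983to89.Node00.BetaInputIntegrable

/-!
# NODE N09 [B12] — ROAD A′ RE-BASED ON THE χ-SUPPORT IS A TOWER CHART, AT THE STAGE-13 RECORD: the four measure-theoretic per-step sockets `hΦ hJ havgΦ hmap` of
# dag-n09-w1 g5's (F1) regularity tower, binder shapes VERBATIM, from dag-n09-w6 g3's per-bond inversion data at the central `α`-windows + [B11]-existence + (H-U) + numerics

Cell `pub-ymgap` (YM-PLAN Track A), width seat `pub-ymgap-dag-n09-w5` g4 (D-0154 ∕ R399 (3a) width seat 5 of node N09), FILE 3 (sequel of FILE 2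
`…N09TowerChartOfPerBondCharts`, split for the 400-line limit); helper of K1⁸ `StabilityBRunRowsAtRecordR13SepCoPH` = stmt-QuantumFields-26907 (`--supports`, `--as helper`,
count-neutral).  [I] = [Balaban1987RG1] (CMP 109), [B11] = [Balaban1985Variational].

WHAT IS PROVED (theorems only; 0 def, 0 instance, 0 notation, 0 sorry).  One level `j < K`; `R := {chiFixed29 θ₀.ν θ₀.ε₂₉ K g j ≠ 0}` (`= {chiβOfRecord₁₃ θ₀ K g j ≠ 0}`
by `rfl`), `σ := critCfgOfRecord θ₀.ν K j`, `Ω :=` the central α-window `{g | ∀ i, dist1 (fibreFamily U c (pre U c · g · post U c) i) ≤ α}`, `U₀ := domAltOfRecord θ₀.ν K (j+1)`;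
the statements are generic in the decidability instance of the rebase set (a `[DecidablePred (· ∈ A)]` binder, as in FILE 2).
* ★★ `chiSupport_inter_subset_centralWindow_of_hsolν_of_numerics` — FILE 1's support clause (`…N09SupportClauseAtRecord`, p622515) in χ-form: `Ū⁻¹(domAlt_{j+1}) ∩ {χ^{(2.9)}_j ≠ 0}`
  lies in the window set, for `(((d+2)L)²∕4)·θ₀.ν.ε₀ ≤ α` (contrapositive of dag-n09-w4 g3's `hχdom_of_hsolν_of_numerics` + K0e's `Iff.rfl` + FILE 1 §1).
* `measurableSet_chiSupport` ((H-U) `hU : ∀ k, Measurable (Uk F N K (k+1) ν.εreg)` ⇒ `{χ^{(2.9)}_j ≠ 0}` measurable — K0e's `measurable_chiFixed29_of`).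
* ★ `tower_hΦ_of_perBondCharts` · ★ `tower_hJ_of_perBondCharts` · ★★ `tower_havgΦ_of_perBondCharts_of_hsolν` · ★★★ `tower_hmap_of_perBondCharts_of_hsolν_of_numerics` — the four
  measure-theoretic sockets of `…N09RegularityTowerOfGeometricChartData.hreg_pos_all_of_geometricChartData` at level `j`, at `Z j := GaugeField (F.P K) j (SU N)`, `τ j := fieldMeasure`,
  for the tower chart `Φ′` and Jacobian `J′` of FILE 2 — from road-A′ data `(T, ϑ, jd; hTm hθm hjm hright hlaw)` at the central α-windows, their measurability `hΩm` and blindness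
  `hΩbl` (dag-n09-w6 g3's announced `…N09CentralWindowAtRecord`), [B11]-existence `hsolν`, (H-U) `hU`, dag-n09-w4 g3's seven numerics + `hord`, and `(((d+2)L)²∕4)·θ₀.ν.ε₀ ≤ α`.

HONEST FRAMING.  LOCATED, count-neutral measure theory BY NAME; NO regularity socket (`hconf hΦV hJV hz₀ hΦc hJpos`), NO Jacobian law, NO `hnull`, NO chart of Bałaban's ((2.10))
constructed; `hsolν`, `hU`, the per-bond inversion data and the numerics stay DISPLAYED; `hreg` NOT discharged; NOTHING of Bałaban's proved or denied; N09 NOT discharged;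
conjunct 1 (Lemma 4) and FLAG №7 untouched; K0⁷ ∕ K1⁸ ∕ K3⁷ NOT closed; counts unmoved (typed 28∕28 · discharged 5∕28); no summit statement is proved by this seat; one finite
four-torus programme at fixed `ε = L^{−K}` per run — R4 closes the conditional rung `BalabanLadder.UV` only; NOT continuum ∕ ℝ⁴ ∕ infinite volume ∕ OS; the Yang–Mills mass gap
(Clay) is NOT proved by any of this.
-/

noncomputable section

namespace Summit.QuantumFields.YangMills.BalabanUVNodes.N09TowerChartOfPerBondChartsAtRecord

open MeasureTheory Set Function
open scoped ENNReal NNReal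
open Literature.MathematicalPhysics.QuantumFieldTheory.Balaban1983to89
open Literature.MathematicalPhysics.QuantumFieldTheory.Balaban1983to89.T4Continuum (T4Family)
open Literature.MathematicalPhysics.QuantumFieldTheory.Balaban1983to89.Node00
open Literature.MathematicalPhysics.QuantumFieldTheory.Balaban1983to89.ExpMeanLog (deltaSU)
open Literature.MathematicalPhysics.QuantumFieldTheory.Balaban1983to89.BlockAveraging (Idx loopHol)
open Literature.MathematicalPhysics.QuantumFieldTheory.Balaban1983to89.BlockAveragingHaarAC (centralBond pre post)
open Literature.MathematicalPhysics.QuantumFieldTheory.Balaban1983to89.BlockAveragingEMLHaarAC (fibreFamily)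
open N09SupportClauseAtRecord (self_mem_centralWindow_of_plaqSmall ε₀_nonneg_of_hord)
open N09B0RiderAtRecord (hχdom_of_hsolν_of_numerics)
open N09LiftInvariance29AtRecord (succ_le_range_of_lt)
open N09TowerChartOfPerBondCharts (measurable_towerChart measurable_towerJacobian avOfRecord_towerChart_eq fieldMeasure_restrict_inter_eq_map_towerChart)

variable {F : T4Family} {N : ℕ} [NeZero N]

/-- ★★ **THE SUPPORT CLAUSE, χ-FORM** (FILE 1's `supportClauseOn_of_hsolν_of_numerics` one step earlier in its chain): for `j < K`, `Ū⁻¹(domAlt_{j+1}) ∩ {χ^{(2.9)}_j ≠ 0}`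
lies inside the window set of the central `α`-windows, `(((d+2)L)²∕4)·θ₀.ν.ε₀ ≤ α` — contrapositive of dag-n09-w4 g3's `hχdom_of_hsolν_of_numerics` + K0e's `Iff.rfl` + FILE 1 §1.
CONDITIONAL on `hsolν` + numerics. [cite: Balaban1987RG1, (2.9) p.266, p.267 and (0.4) p.253; Balaban1988Convergent, p.265; Balaban1985Averaging, (19)–(20) p.21 and Prop. 2 (53) p.26] -/
theorem chiSupport_inter_subset_centralWindow_of_hsolν_of_numerics (θ₀ : Stage13Params F N) (K : ℕ) (g : ℕ → ℝ) (hεreg : 0 < θ₀.ν.εreg)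
    (hε3 : (143 * (((((F.P K).d + 4 : ℕ) : ℝ)) ^ 2 / 4) ^ 2) * θ₀.ν.εreg ≤ 1 / 3)
    (hε2 : 2 * θ₀.ν.εreg ≤ 2 * deltaSU (Fin N) / ((((F.P K).d + 4) * (F.P K).L : ℕ) : ℝ) ^ 2) (hε29 : 0 ≤ θ₀.ε₂₉)
    (hn1 : 1640 * (2 * (((((F.P K).d + 2) * (F.P K).L : ℕ) : ℝ) * θ₀.ε₂₉) +
        ((((F.P K).d + 2) * (F.P K).L : ℕ) : ℝ) ^ 2 / 4 * (2 * θ₀.ν.εreg / ((F.P K).L : ℝ) ^ 2)) * (((F.P K).L : ℝ) ^ ((F.P K).d - 1)) ^ 2 ≤ 1)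
    (hn2 : 13 * (2 * (((((F.P K).d + 2) * (F.P K).L : ℕ) : ℝ) * θ₀.ε₂₉) +
        ((((F.P K).d + 2) * (F.P K).L : ℕ) : ℝ) ^ 2 / 4 * (2 * θ₀.ν.εreg / ((F.P K).L : ℝ) ^ 2)) * ((F.P K).L : ℝ) ^ ((F.P K).d - 1) < deltaSU (Fin N))
    (hord : 2 * θ₀.ν.εreg / ((F.P K).L : ℝ) ^ 2 +
      4 * max θ₀.ε₂₉ (10 * (((((F.P K).d + 2) * (F.P K).L : ℕ) : ℝ) * θ₀.ε₂₉) * ((F.P K).L : ℝ) ^ ((F.P K).d - 1)) ≤ θ₀.ν.ε₀)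
    (hsolν : ∀ j < K, ∀ W ∈ domAltOfRecord F N θ₀.ν K (j + 1), UkExists F N K (j + 1) θ₀.ν.εreg W)
    {α : ℝ} (hα : ((((F.P K).d + 2) * (F.P K).L : ℕ) : ℝ) ^ 2 / 4 * θ₀.ν.ε₀ ≤ α) :
    ∀ j < K, (avOfRecord F N K j).avg ⁻¹' domAltOfRecord F N θ₀.ν K (j + 1) ∩ {U | chiFixed29 F N θ₀.ν θ₀.ε₂₉ K g j U ≠ 0} ⊆
      {U : GaugeField (F.P K) j (SU N) | ∀ c : PBond (F.P K) (j + 1),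
        U (centralBond c) ∈ {g' : SU N | ∀ i : Idx (F.P K), dist1 (fibreFamily U c (pre U c * g' * post U c) i) ≤ α}} := by
  intro j hj U hU c
  have hmem : U ∈ domAltOfRecord F N θ₀.ν K j := by
    by_contra hU'
    exact hU.2 (hχdom_of_hsolν_of_numerics θ₀ K g hεreg hε3 hε2 hε29 hn1 hn2 hord hsolν j hj U hU.1 hU')
  exact self_mem_centralWindow_of_plaqSmall (succ_le_range_of_lt hj) (ε₀_nonneg_of_hord θ₀ K hεreg hε29 hord) U
    ((mem_domAltOfRecord_iff F N θ₀.ν K j U).1 hmem) hα c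

section Record

variable {K j : ℕ} (T : PBond (F.P K) (j + 1) → GaugeField (F.P K) j (SU N) → Set (SU N))
  (ϑ : PBond (F.P K) (j + 1) → GaugeField (F.P K) j (SU N) → SU N → SU N)
  (jd : PBond (F.P K) (j + 1) → GaugeField (F.P K) j (SU N) → SU N → ℝ≥0)

/-- `{χ^{(2.9)}_j ≠ 0}` is measurable as soon as the minimiser of record is ((H-U) species; K0e's `measurable_chiFixed29_of`). [cite: Balaban1987RG1, (2.9) p.266 (bookkeeping)] -/
theorem measurableSet_chiSupport (ν : Stage7Numerics) (ε₁ : ℝ) (g : ℕ → ℝ) (hU : ∀ k, Measurable (Uk F N K (k + 1) ν.εreg)) :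
    MeasurableSet {U : GaugeField (F.P K) j (SU N) | chiFixed29 F N ν ε₁ K g j U ≠ 0} :=
  (measurable_chiFixed29_of ε₁ hU g j) (measurableSet_singleton (0 : ℝ)).compl

/-- ★ **SOCKET `hΦ` AT LEVEL `j`**: the tower chart of road A′ re-based on `{χ^{(2.9)}_j ≠ 0}` with fallback `V^{(j)}` is measurable ((H-U) `hU` displayed).
[cite: Balaban1987RG1, (2.3) p.265, (2.9) p.266 and (2.10) p.267 (bookkeeping)] -/
theorem tower_hΦ_of_perBondCharts (ν : Stage7Numerics) (ε₁ : ℝ) (g : ℕ → ℝ) (hj : j < K)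
    (hTm : ∀ c, MeasurableSet {p : GaugeField (F.P K) j (SU N) × SU N | p.2 ∈ T c p.1})
    (hθm : ∀ c, Measurable fun p : GaugeField (F.P K) j (SU N) × SU N => ϑ c p.1 p.2)
    (hjm : ∀ c, Measurable fun p : GaugeField (F.P K) j (SU N) × SU N => jd c p.1 p.2)
    (hU : ∀ k, Measurable (Uk F N K (k + 1) ν.εreg))
    [DecidablePred (· ∈ {p : (PBond (F.P K) (j + 1) → SU N) × GaugeField (F.P K) j (SU N) |
      {q : (PBond (F.P K) (j + 1) → SU N) × GaugeField (F.P K) j (SU N) | ∀ c, q.1 c ∈ T c q.2}.indicator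
          (fun q => ∏ c, jd c q.2 (q.1 c)) p ≠ 0 ∧
        (extend centralBond (fun c => ϑ c p.2 (p.1 c)) p.2 : GaugeField (F.P K) j (SU N)) ∈
          {U : GaugeField (F.P K) j (SU N) | chiFixed29 F N ν ε₁ K g j U ≠ 0}})] :
    Measurable fun p : (PBond (F.P K) (j + 1) → SU N) × GaugeField (F.P K) j (SU N) =>
      {p : (PBond (F.P K) (j + 1) → SU N) × GaugeField (F.P K) j (SU N) |
          {q : (PBond (F.P K) (j + 1) → SU N) × GaugeField (F.P K) j (SU N) | ∀ c, q.1 c ∈ T c q.2}.indicator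
              (fun q => ∏ c, jd c q.2 (q.1 c)) p ≠ 0 ∧
            (extend centralBond (fun c => ϑ c p.2 (p.1 c)) p.2 : GaugeField (F.P K) j (SU N)) ∈
              {U : GaugeField (F.P K) j (SU N) | chiFixed29 F N ν ε₁ K g j U ≠ 0}}.piecewise
        (fun p => (extend centralBond (fun c => ϑ c p.2 (p.1 c)) p.2 : GaugeField (F.P K) j (SU N)))
        (fun p => critCfgOfRecord F N ν K j p.1) p :=
  measurable_towerChart T ϑ jd {U : GaugeField (F.P K) j (SU N) | chiFixed29 F N ν ε₁ K g j U ≠ 0} (critCfgOfRecord F N ν K j) hj hTm hθm hjm (measurableSet_chiSupport ν ε₁ g hU)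
    (measurable_critCfgOfRecord_of (hU j))

/-- ★ **SOCKET `hJ` AT LEVEL `j`**: the tower Jacobian is measurable. [cite: Balaban1987RG1, (2.9) p.266 and (2.10) p.267 (bookkeeping)] -/
theorem tower_hJ_of_perBondCharts (ν : Stage7Numerics) (ε₁ : ℝ) (g : ℕ → ℝ) (hj : j < K)
    (hTm : ∀ c, MeasurableSet {p : GaugeField (F.P K) j (SU N) × SU N | p.2 ∈ T c p.1})
    (hθm : ∀ c, Measurable fun p : GaugeField (F.P K) j (SU N) × SU N => ϑ c p.1 p.2)
    (hjm : ∀ c, Measurable fun p : GaugeField (F.P K) j (SU N) × SU N => jd c p.1 p.2)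
    (hU : ∀ k, Measurable (Uk F N K (k + 1) ν.εreg)) :
    Measurable fun p : (PBond (F.P K) (j + 1) → SU N) × GaugeField (F.P K) j (SU N) =>
      {p : (PBond (F.P K) (j + 1) → SU N) × GaugeField (F.P K) j (SU N) |
          {q : (PBond (F.P K) (j + 1) → SU N) × GaugeField (F.P K) j (SU N) | ∀ c, q.1 c ∈ T c q.2}.indicator
              (fun q => ∏ c, jd c q.2 (q.1 c)) p ≠ 0 ∧
            (extend centralBond (fun c => ϑ c p.2 (p.1 c)) p.2 : GaugeField (F.P K) j (SU N)) ∈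
              {U : GaugeField (F.P K) j (SU N) | chiFixed29 F N ν ε₁ K g j U ≠ 0}}.indicator
        ({q : (PBond (F.P K) (j + 1) → SU N) × GaugeField (F.P K) j (SU N) | ∀ c, q.1 c ∈ T c q.2}.indicator
          fun q => ∏ c, jd c q.2 (q.1 c)) p :=
  measurable_towerJacobian T ϑ jd {U : GaugeField (F.P K) j (SU N) | chiFixed29 F N ν ε₁ K g j U ≠ 0} hj hTm hθm hjm (measurableSet_chiSupport ν ε₁ g hU)

/-- ★★ **SOCKET `havgΦ` AT LEVEL `j`, EVERYWHERE ON `domAlt_{j+1}`** — from road A′'s `hright` and [B11]-existence `hsolν` on the domain (the fallback `V^{(j)}(V)` averages to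
`V` there, `Node00.avg_critCfgOfRecord`). [cite: Balaban1987RG1, (2.3)–(2.4) pp.265–266 and (2.10) p.267; Balaban1985Variational, Thm 1 (8)–(10) p.279] -/
theorem tower_havgΦ_of_perBondCharts_of_hsolν (ν : Stage7Numerics) (ε₁ : ℝ) (g : ℕ → ℝ) [DecidableEq (PBond (F.P K) j)] (hj : j < K)
    (hright : ∀ c U, ∀ v ∈ T c U, (avOfRecord F N K j).avg (update U (centralBond c) (ϑ c U v)) c = v)
    (hsolν : ∀ W ∈ domAltOfRecord F N ν K (j + 1), UkExists F N K (j + 1) ν.εreg W)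
    [DecidablePred (· ∈ {p : (PBond (F.P K) (j + 1) → SU N) × GaugeField (F.P K) j (SU N) |
      {q : (PBond (F.P K) (j + 1) → SU N) × GaugeField (F.P K) j (SU N) | ∀ c, q.1 c ∈ T c q.2}.indicator
          (fun q => ∏ c, jd c q.2 (q.1 c)) p ≠ 0 ∧
        (extend centralBond (fun c => ϑ c p.2 (p.1 c)) p.2 : GaugeField (F.P K) j (SU N)) ∈
          {U : GaugeField (F.P K) j (SU N) | chiFixed29 F N ν ε₁ K g j U ≠ 0}})] :
    ∀ V ∈ domAltOfRecord F N ν K (j + 1), ∀ z : GaugeField (F.P K) j (SU N), (avOfRecord F N K j).avg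
      ({p : (PBond (F.P K) (j + 1) → SU N) × GaugeField (F.P K) j (SU N) |
          {q : (PBond (F.P K) (j + 1) → SU N) × GaugeField (F.P K) j (SU N) | ∀ c, q.1 c ∈ T c q.2}.indicator
              (fun q => ∏ c, jd c q.2 (q.1 c)) p ≠ 0 ∧
            (extend centralBond (fun c => ϑ c p.2 (p.1 c)) p.2 : GaugeField (F.P K) j (SU N)) ∈
              {U : GaugeField (F.P K) j (SU N) | chiFixed29 F N ν ε₁ K g j U ≠ 0}}.piecewise
        (fun p => (extend centralBond (fun c => ϑ c p.2 (p.1 c)) p.2 : GaugeField (F.P K) j (SU N)))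
        (fun p => critCfgOfRecord F N ν K j p.1) (V, z)) = V :=
  avOfRecord_towerChart_eq T ϑ jd {U : GaugeField (F.P K) j (SU N) | chiFixed29 F N ν ε₁ K g j U ≠ 0} (critCfgOfRecord F N ν K j) hj hright fun V hV => avg_critCfgOfRecord (hsolν V hV)

end Record

/-- ★★★ **SOCKET `hmap` AT LEVEL `j`, BINDER SHAPE OF THE TOWER VERBATIM** (`…N09RegularityTowerOfGeometricChartData.hreg_pos_all_of_geometricChartData` at
`Z j := GaugeField (F.P K) j (SU N)`, `τ j := fieldMeasure`): `dU⌊(Ū⁻¹ domAlt_{j+1} ∩ {χ^{(2.9)}_j ≠ 0}) = Φ′_*(((dV⌊domAlt_{j+1}) ⊗ dU)·J′)` for the tower chart of road A′ at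
the CENTRAL `α`-WINDOWS re-based on the χ-support with fallback `V^{(j)}` — from dag-n09-w6 g3's per-bond inversion data `(T, ϑ, jd; hTm hθm hjm hright hlaw)` at those windows,
their measurability `hΩm` and blindness `hΩbl`, [B11]-existence `hsolν`, (H-U) `hU`, dag-n09-w4 g3's seven numerics + `hord`, and `(((d+2)L)²∕4)·θ₀.ν.ε₀ ≤ α` (§2 with
`hRW :=` the support clause).  CONDITIONAL; the inversions are displayed, not constructed; nothing of Bałaban's asserted; `hreg` NOT discharged.
[cite: Balaban1987RG1, p.259, (0.4) p.253, (2.3)–(2.4) pp.265–266, (2.9)–(2.10) pp.266–267 and (0.13) p.254; Balaban1985Averaging, (19)–(20) p.21 and Prop. 2 (53) p.26] -/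
theorem tower_hmap_of_perBondCharts_of_hsolν_of_numerics (θ₀ : Stage13Params F N) (K : ℕ) (g : ℕ → ℝ) {j : ℕ}
    [DecidableEq (PBond (F.P K) j)] (hj : j < K) {α : ℝ}
    (T : PBond (F.P K) (j + 1) → GaugeField (F.P K) j (SU N) → Set (SU N))
    (ϑ : PBond (F.P K) (j + 1) → GaugeField (F.P K) j (SU N) → SU N → SU N)
    (jd : PBond (F.P K) (j + 1) → GaugeField (F.P K) j (SU N) → SU N → ℝ≥0)
    (hΩm : ∀ c : PBond (F.P K) (j + 1),
      MeasurableSet {p : GaugeField (F.P K) j (SU N) × SU N | ∀ i : Idx (F.P K), dist1 (fibreFamily p.1 c (pre p.1 c * p.2 * post p.1 c) i) ≤ α})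
    (hTm : ∀ c, MeasurableSet {p : GaugeField (F.P K) j (SU N) × SU N | p.2 ∈ T c p.1})
    (hθm : ∀ c, Measurable fun p : GaugeField (F.P K) j (SU N) × SU N => ϑ c p.1 p.2)
    (hjm : ∀ c, Measurable fun p : GaugeField (F.P K) j (SU N) × SU N => jd c p.1 p.2)
    (hΩbl : ∀ (c : PBond (F.P K) (j + 1)) (U : GaugeField (F.P K) j (SU N)) (g' : PBond (F.P K) (j + 1) → SU N),
      {g : SU N | ∀ i : Idx (F.P K), dist1 (fibreFamily (extend centralBond g' U) c
          (pre (extend centralBond g' U) c * g * post (extend centralBond g' U) c) i) ≤ α} =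
        {g : SU N | ∀ i : Idx (F.P K), dist1 (fibreFamily U c (pre U c * g * post U c) i) ≤ α})
    (hright : ∀ c U, ∀ v ∈ T c U, (avOfRecord F N K j).avg (update U (centralBond c) (ϑ c U v)) c = v)
    (hlaw : ∀ (c : PBond (F.P K) (j + 1)) (U : GaugeField (F.P K) j (SU N)),
      (HaarData.haar : Measure (SU N)).restrict {g : SU N | ∀ i : Idx (F.P K), dist1 (fibreFamily U c (pre U c * g * post U c) i) ≤ α} =
        (((HaarData.haar : Measure (SU N)).restrict (T c U)).withDensity fun v => (jd c U v : ℝ≥0∞)).map (ϑ c U))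
    (hU : ∀ k, Measurable (Uk F N K (k + 1) θ₀.ν.εreg)) (hεreg : 0 < θ₀.ν.εreg)
    (hε3 : (143 * (((((F.P K).d + 4 : ℕ) : ℝ)) ^ 2 / 4) ^ 2) * θ₀.ν.εreg ≤ 1 / 3)
    (hε2 : 2 * θ₀.ν.εreg ≤ 2 * deltaSU (Fin N) / ((((F.P K).d + 4) * (F.P K).L : ℕ) : ℝ) ^ 2) (hε29 : 0 ≤ θ₀.ε₂₉)
    (hn1 : 1640 * (2 * (((((F.P K).d + 2) * (F.P K).L : ℕ) : ℝ) * θ₀.ε₂₉) +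
        ((((F.P K).d + 2) * (F.P K).L : ℕ) : ℝ) ^ 2 / 4 * (2 * θ₀.ν.εreg / ((F.P K).L : ℝ) ^ 2)) * (((F.P K).L : ℝ) ^ ((F.P K).d - 1)) ^ 2 ≤ 1)
    (hn2 : 13 * (2 * (((((F.P K).d + 2) * (F.P K).L : ℕ) : ℝ) * θ₀.ε₂₉) +
        ((((F.P K).d + 2) * (F.P K).L : ℕ) : ℝ) ^ 2 / 4 * (2 * θ₀.ν.εreg / ((F.P K).L : ℝ) ^ 2)) * ((F.P K).L : ℝ) ^ ((F.P K).d - 1) < deltaSU (Fin N))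
    (hord : 2 * θ₀.ν.εreg / ((F.P K).L : ℝ) ^ 2 +
      4 * max θ₀.ε₂₉ (10 * (((((F.P K).d + 2) * (F.P K).L : ℕ) : ℝ) * θ₀.ε₂₉) * ((F.P K).L : ℝ) ^ ((F.P K).d - 1)) ≤ θ₀.ν.ε₀)
    (hsolν : ∀ j < K, ∀ W ∈ domAltOfRecord F N θ₀.ν K (j + 1), UkExists F N K (j + 1) θ₀.ν.εreg W)
    (hα : ((((F.P K).d + 2) * (F.P K).L : ℕ) : ℝ) ^ 2 / 4 * θ₀.ν.ε₀ ≤ α)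
    [DecidablePred (· ∈ {p : (PBond (F.P K) (j + 1) → SU N) × GaugeField (F.P K) j (SU N) |
      {q : (PBond (F.P K) (j + 1) → SU N) × GaugeField (F.P K) j (SU N) | ∀ c, q.1 c ∈ T c q.2}.indicator
          (fun q => ∏ c, jd c q.2 (q.1 c)) p ≠ 0 ∧
        (extend centralBond (fun c => ϑ c p.2 (p.1 c)) p.2 : GaugeField (F.P K) j (SU N)) ∈
          {U : GaugeField (F.P K) j (SU N) | chiFixed29 F N θ₀.ν θ₀.ε₂₉ K g j U ≠ 0}})] :
    (fieldMeasure (F.P K) j (SU N)).restrict ((avOfRecord F N K j).avg ⁻¹' domAltOfRecord F N θ₀.ν K (j + 1) ∩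
        {U | chiFixed29 F N θ₀.ν θ₀.ε₂₉ K g j U ≠ 0}) =
      ((((piHaar (F.P K) (j + 1) (SU N)).restrict (domAltOfRecord F N θ₀.ν K (j + 1))).prod (fieldMeasure (F.P K) j (SU N))).withDensity fun p =>
          (({p : (PBond (F.P K) (j + 1) → SU N) × GaugeField (F.P K) j (SU N) |
              {q : (PBond (F.P K) (j + 1) → SU N) × GaugeField (F.P K) j (SU N) | ∀ c, q.1 c ∈ T c q.2}.indicator
                  (fun q => ∏ c, jd c q.2 (q.1 c)) p ≠ 0 ∧
                (extend centralBond (fun c => ϑ c p.2 (p.1 c)) p.2 : GaugeField (F.P K) j (SU N)) ∈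
                  {U : GaugeField (F.P K) j (SU N) | chiFixed29 F N θ₀.ν θ₀.ε₂₉ K g j U ≠ 0}}.indicator
            ({q : (PBond (F.P K) (j + 1) → SU N) × GaugeField (F.P K) j (SU N) | ∀ c, q.1 c ∈ T c q.2}.indicator
              fun q => ∏ c, jd c q.2 (q.1 c)) p : ℝ≥0) : ℝ≥0∞)).map
        (fun p : (PBond (F.P K) (j + 1) → SU N) × GaugeField (F.P K) j (SU N) =>
          {p : (PBond (F.P K) (j + 1) → SU N) × GaugeField (F.P K) j (SU N) |
              {q : (PBond (F.P K) (j + 1) → SU N) × GaugeField (F.P K) j (SU N) | ∀ c, q.1 c ∈ T c q.2}.indicator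
                  (fun q => ∏ c, jd c q.2 (q.1 c)) p ≠ 0 ∧
                (extend centralBond (fun c => ϑ c p.2 (p.1 c)) p.2 : GaugeField (F.P K) j (SU N)) ∈
                  {U : GaugeField (F.P K) j (SU N) | chiFixed29 F N θ₀.ν θ₀.ε₂₉ K g j U ≠ 0}}.piecewise
            (fun p => (extend centralBond (fun c => ϑ c p.2 (p.1 c)) p.2 : GaugeField (F.P K) j (SU N)))
            (fun p => critCfgOfRecord F N θ₀.ν K j p.1) p) :=
  fieldMeasure_restrict_inter_eq_map_towerChart
    (fun c U => {g : SU N | ∀ i : Idx (F.P K), dist1 (fibreFamily U c (pre U c * g * post U c) i) ≤ α}) T ϑ jd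
    {U : GaugeField (F.P K) j (SU N) | chiFixed29 F N θ₀.ν θ₀.ε₂₉ K g j U ≠ 0} (critCfgOfRecord F N θ₀.ν K j) hj hΩm hTm hθm hjm hΩbl hright hlaw
    (IsOpen.measurableSet (α := PBond (F.P K) (j + 1) → SU N) (B12ContinuousTransportInvarianceOn.isOpen_domAltOfRecord θ₀.ν K (j + 1)))
    (measurableSet_chiSupport θ₀.ν θ₀.ε₂₉ g hU)
    (chiSupport_inter_subset_centralWindow_of_hsolν_of_numerics θ₀ K g hεreg hε3 hε2 hε29 hn1 hn2 hord hsolν hα j hj)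

end Summit.QuantumFields.YangMills.BalabanUVNodes.N09TowerChartOfPerBondChartsAtRecord

end
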